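import Summits.BirchSwinnertonDyer.BirchSwinnertonDyer.Theorems.KimAtThreeDeepLowerKatoExactFinal
import Summits.BirchSwinnertonDyer.BirchSwinnertonDyer.Theorems.KimAtThreeDeepLowerKatoLit
import HarnessLib

/-!
# The deep leaf of W2 (`DeepLowerAtThree`, 19075) BY NAME from CITE-ONLY named facts
# (cell `bsd-addord`, seat w2-c2 gen 9; route W2 `KimAtThreeKolyvagin`; `--supports stmt-BirchSwinnertonDyer-19075`, helper)

HONEST FRAMING.  Glue only (theorems; no definition, no instance, no `sorry`).  Every hypothesis below is a NAMED,
CITE-ONLY Literature fact (a `def … : Prop` with a locator, unproved in the tree): the four leaves of the route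
(`SakamotoKolyvaginThree`, `RankEqAnalyticRankLeOne`, `PoitouTateSelmerDuality`, `CarayolLevelEqConductor`), the five
`DualExpElliptic(-Tower)` facts (Kato 1993 Prop. 1.2.3 / Thm. 1.4.1, Bloch–Kato 1990 §3), and Kato 2004 with DEFINED `exp*`
VALUES (`Kato2004.exists_eulerSystem_definedExpStar_values`).  So these theorems are CONDITIONAL results: they show that the
deep items 19075 / 19679 / 19076∧ / 19562 / `N11.KimAtThreeDeepPUB` / 20013 now rest on cite facts ALONE — no displayed
package, no registered residual — and close nothing unconditionally; BSD is not proved by any of this.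
Composition: `KimAtThreeDeepLowerKatoExactFinal.*_of_katoExact_of_facts` (p523832) at
`hKatoEx := KimAtThreeDeepLowerKatoLit.katoExact_of_lit hP hDR hLit`.
-/

noncomputable section

-- the cell's Theorems namespace `Summit.BirchSwinnertonDyer.BirchSwinnertonDyer.…` repeats the summit name by design (D-0017)
set_option linter.dupNamespace false

open Literature.NumberTheory.EllipticCurves Literature.NumberTheory.PAdicHodge
open Literature.NumberTheory.EllipticCurves.Kato2004
open Summit.BirchSwinnertonDyer.BirchSwinnertonDyer.Theses.KimAtThreeKolyvagin
open Summit.BirchSwinnertonDyer.BirchSwinnertonDyer.Theorems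
open Summit.BirchSwinnertonDyer.BirchSwinnertonDyer.Theorems.KimAtThreeDeepLowerKatoExactFinal
open Summit.BirchSwinnertonDyer.BirchSwinnertonDyer.Theorems.KimAtThreeDeepLowerKatoLit

namespace Summit.BirchSwinnertonDyer.BirchSwinnertonDyer.Theorems.KimAtThreeDeepLowerKatoCiteOnly

/-- **Item `DefinedKatoUniformThree` (20013) from cite-only named facts.** Conditional.
[cite: Kato2004Asterisque, Thm. 12.5, (8.1.3), §9.4–9.7] [cite: Kato1993LNM1553, Ch. II Prop. 1.2.3, Thm. 1.4.1] [cite: BlochKato1990, §3] -/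
theorem definedKatoUniformThree_of_cites (hP : cupLogInjective_and_hasDualExp_of_isDeRham)
    (hDR : isDeRham_restrictedRationalTateRep) (hS : expStarCoord_eq_zero_iff_kummer)
    (hT : exists_smul_range_expStarCoord_iff_trace_log) (hT₂ : exists_smul_range_expStarCoord_tower_iff_trace_log)
    (hLit : exists_eulerSystem_definedExpStar_values) :
    DefinedKatoUniformThree :=
  definedKatoUniformThree_of_katoExact_of_facts (katoExact_of_lit hP hDR hLit) hP hDR hS hT hT₂

variable (hSak : SakamotoKolyvaginThree) (hGZK : RankEqAnalyticRankLeOne) (hPT : PoitouTateSelmerDuality)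
include hSak hGZK hPT

/-- ★★★ **Crux `DeepLowerAtThree` (19075) BY NAME from cite-only named facts.** Conditional (module docstring).
[cite: Kato2004Asterisque, Thm. 12.5, (8.1.3), Prop. 8.12, §9.4–9.7, Thm. 6.6 (1), Ex. 13.3] [cite: Kim2025RefinedTNC, Thm 1.1]
[cite: Sakamoto2024, Thm. 4.4 (1)(2) (p. 926)] [cite: Kato1993LNM1553, Ch. II Prop. 1.2.3, Thm. 1.4.1] [cite: BlochKato1990, §3] -/
theorem deepLowerAtThree_of_cites (hP : cupLogInjective_and_hasDualExp_of_isDeRham)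
    (hDR : isDeRham_restrictedRationalTateRep) (hS : expStarCoord_eq_zero_iff_kummer)
    (hT : exists_smul_range_expStarCoord_iff_trace_log) (hT₂ : exists_smul_range_expStarCoord_tower_iff_trace_log)
    (hLit : exists_eulerSystem_definedExpStar_values)
    (hlev : CarayolLevelEqConductor) :
    Summit.BirchSwinnertonDyer.BirchSwinnertonDyer.Theses.KimAtThreeKolyvagin.DeepLowerAtThree :=
  deepLowerAtThree_of_katoExact_of_facts (katoExact_of_lit hP hDR hLit) hSak hGZK hPT hP hDR hS hT hT₂ hlev

/-- **Crux `DeepLowerAtThreeOffKatoStratum` (19679) BY NAME from cite-only named facts.** Conditional.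
[cite: Kato2004Asterisque, Thm. 12.5, §9.4–9.7] [cite: Kim2025RefinedTNC, Thm 1.1] [cite: Sakamoto2024, Thm. 4.4 (1)(2) (p. 926)] -/
theorem deepLowerAtThreeOffKatoStratum_of_cites (hP : cupLogInjective_and_hasDualExp_of_isDeRham)
    (hDR : isDeRham_restrictedRationalTateRep) (hS : expStarCoord_eq_zero_iff_kummer)
    (hT : exists_smul_range_expStarCoord_iff_trace_log) (hT₂ : exists_smul_range_expStarCoord_tower_iff_trace_log)
    (hLit : exists_eulerSystem_definedExpStar_values) :
    Summit.BirchSwinnertonDyer.BirchSwinnertonDyer.Theses.KimAtThreeKolyvagin.DeepLowerAtThreeOffKatoStratum :=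
  deepLowerAtThreeOffKatoStratum_of_katoExact_of_facts (katoExact_of_lit hP hDR hLit) hSak hGZK hPT hP hDR hS hT hT₂

/-- **`DeepLowerAtThree ∧ DeepUpperAtThree` (19075 ∧ 19076) from cite-only named facts.** Conditional.
[cite: Kato2004Asterisque, Thm. 12.5, §9.4–9.7] [cite: Kim2025RefinedTNC, Thm 1.1] -/
theorem deepLower_and_deepUpper_of_cites (hP : cupLogInjective_and_hasDualExp_of_isDeRham)
    (hDR : isDeRham_restrictedRationalTateRep) (hS : expStarCoord_eq_zero_iff_kummer)
    (hT : exists_smul_range_expStarCoord_iff_trace_log) (hT₂ : exists_smul_range_expStarCoord_tower_iff_trace_log)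
    (hLit : exists_eulerSystem_definedExpStar_values)
    (hlev : CarayolLevelEqConductor) :
    Summit.BirchSwinnertonDyer.BirchSwinnertonDyer.Theses.KimAtThreeKolyvagin.DeepLowerAtThree ∧
      Summit.BirchSwinnertonDyer.BirchSwinnertonDyer.Theses.KimAtThreeKolyvagin.DeepUpperAtThree :=
  deepLower_and_deepUpper_of_katoExact_of_facts (katoExact_of_lit hP hDR hLit) hSak hGZK hPT hP hDR hS hT hT₂ hlev

/-- **Crux `DeepUpperAtThreeOffKatoStratum` (19562) BY NAME from cite-only named facts.** Conditional.
[cite: Kato2004Asterisque, Thm. 12.5, §9.4–9.7] [cite: Kim2025RefinedTNC, Thm 1.1] -/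
theorem deepUpperAtThreeOffKatoStratum_of_cites (hP : cupLogInjective_and_hasDualExp_of_isDeRham)
    (hDR : isDeRham_restrictedRationalTateRep) (hS : expStarCoord_eq_zero_iff_kummer)
    (hT : exists_smul_range_expStarCoord_iff_trace_log) (hT₂ : exists_smul_range_expStarCoord_tower_iff_trace_log)
    (hLit : exists_eulerSystem_definedExpStar_values) :
    Summit.BirchSwinnertonDyer.BirchSwinnertonDyer.Theses.KimAtThreeKolyvagin.DeepUpperAtThreeOffKatoStratum :=
  deepUpperAtThreeOffKatoStratum_of_katoExact_of_facts (katoExact_of_lit hP hDR hLit) hSak hGZK hPT hP hDR hS hT hT₂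

/-- ★★ **`N11.KimAtThreeDeepPUB` from cite-only named facts.** Conditional; nothing about BSD is proved.
[cite: Kato2004Asterisque, Thm. 12.5, §9.4–9.7] [cite: Kim2025RefinedTNC, Thm 1.1] -/
theorem kimAtThreeDeepPUB_of_cites (hP : cupLogInjective_and_hasDualExp_of_isDeRham)
    (hDR : isDeRham_restrictedRationalTateRep) (hS : expStarCoord_eq_zero_iff_kummer)
    (hT : exists_smul_range_expStarCoord_iff_trace_log) (hT₂ : exists_smul_range_expStarCoord_tower_iff_trace_log)
    (hLit : exists_eulerSystem_definedExpStar_values)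
    (hlev : CarayolLevelEqConductor) :
    Summit.BirchSwinnertonDyer.Rank1Residual.Additive.N11.KimAtThreeDeepPUB :=
  kimAtThreeDeepPUB_of_katoExact_of_facts (katoExact_of_lit hP hDR hLit) hSak hGZK hPT hP hDR hS hT hT₂ hlev

end Summit.BirchSwinnertonDyer.BirchSwinnertonDyer.Theorems.KimAtThreeDeepLowerKatoCiteOnly

end
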